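import Literature.Probability.Percolation.MarkedLoopLawSlide
import HarnessLib

/-!
# Rootless pendant attachments and the three-valent junction: the link and parity bookkeeping of the cap case of the two-cell surgery («PENDANT-ROOTLESS»)

Topic `Literature/Probability/Percolation`; a rider on `MarkedLoopLawSlide.lean` §1 (#848: `reachable_of_walk_union_pendant`, `reachable_union_pendant(_root)` — ONE root;
`odd_xiDeg_iff_not_iff` — parity of a face with one side excluded) and `MarkedLoopPendantTwoRoots.lean` (#908: two roots). The two remaining pieces of `D`-free bookkeeping
that the lane's TWO-CELL CAP IDENTITY needs (HOME `FINDING-TWO-CELL-CAP-IDENTITY.md` §2, `pub-sawmu-b-engine-2/gen24/DESIGN-next-gen24.md` §2e–§2f): in its CAP CASE the new bonds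
present form a path joining the two new corner faces `a`, `b` through outer faces ONLY (no root: no face off `S` has a side in `E`), and the outer junction face of the two
attached cells is THREE-valent in the new bonds.

* ★ `reachable_union_rootless` — for `X, Y ∉ S`: `X ~ Y` in `ξ ∪ E` iff in `ξ` (a rootless attachment changes no link off `S`);
* ★ `not_reachable_union_rootless` — a face of `S` is linked in `ξ ∪ E` to NO face off `S`;
* ★ `reachable_union_rootless_inner` — two faces of `S` are linked in `ξ ∪ E` iff they are linked inside `E`;
* ★ `odd_xiDeg_iff_three` — **parity at a face all of whose sides may be new**: the side count of `E` at `F` is odd iff an odd number of its three sides lie in `E`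
  (`¬ (s₀ ↔ ¬ (s₁ ↔ s₂))` form), the junction device of the two-cell parity walk.

## References
* M. Khristoforov, S. Smirnov, *Percolation and O(1) loop model*, arXiv:2111.15612v1 (2021), §1.2 (p. 2: «IP(ξ) is a union of disjoint paths, matching marked points»).
* P. A. Pearce, V. Rittenberg, J. de Gier, B. Nienhuis, *Temperley–Lieb stochastic processes*, J. Phys. A 35 (2002) L661–L668, §2 ((monoid): the cap joins `j` to `j+1`).

## Mathlib / tree
Tree: `MarkedLoopLawSlide` (`reachable_of_walk_union_pendant`), `FivePointNormalisation` / `FiveMarkedLoops` (`side`, `sideGraph`, `xiDeg`, `l1_xiDeg_eq`, `side_oppFace_oppIdx`,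
`ht2_sideGraph_mono`). Mathlib: `SimpleGraph.Walk`, `SimpleGraph.Reachable`, `Finset.filter_insert`, `Nat.odd_iff`.
-/

open Finset

namespace Literature.Probability.Percolation.MarkedLoops

open Literature.Probability.Percolation Literature.Probability.LatticeModels
open Literature.Probability.Percolation.FivePoint (side xiDeg)
open Literature.Probability.Percolation.FivePoint.N5 (sideGraph side_oppFace_oppIdx ht2_sideGraph_mono l1_xiDeg_eq)

section Rootless

variable {ξ E : Finset (Sym2 (Site 2))} {S : Finset HexVertex}

/-- ★ **a ROOTLESS attachment changes no link off `S`**: if every side of a face of `S` lying in `ξ ∪ E` lies in `E`, no face off `S` has a side in `E`, and `ξ`, `E` are disjoint,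
then faces `X, Y ∉ S` are linked in `ξ ∪ E` iff they are linked in `ξ`. [cite: KhristoforovSmirnov2021, §1.2 (arXiv v1 p. 2: `IP(ξ)` is a union of disjoint paths)] -/
theorem reachable_union_rootless (hS : ∀ F ∈ S, ∀ j : Fin 3, side F j ∈ ξ ∪ E → side F j ∈ E) (hR : ∀ F, F ∉ S → ∀ j : Fin 3, side F j ∉ E)
    (hdisj : Disjoint ξ E) {X Y : HexVertex} (hX : X ∉ S) (hY : Y ∉ S) : (sideGraph (ξ ∪ E)).Reachable X Y ↔ (sideGraph ξ).Reachable X Y :=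
  reachable_union_pendant (R := X) hS (fun F hF _ => hR F hF) hdisj hX hY

/-- a face of `S` has no `ξ`-side, hence is isolated in the side graph of `ξ`. [cite: KhristoforovSmirnov2021, §1.2 (arXiv v1 p. 2)] -/
theorem eq_of_reachable_of_mem (hS : ∀ F ∈ S, ∀ j : Fin 3, side F j ∈ ξ ∪ E → side F j ∈ E) (hdisj : Disjoint ξ E) {A Y : HexVertex} (hA : A ∈ S)
    (h : (sideGraph ξ).Reachable A Y) : A = Y := by
  obtain ⟨p⟩ := h
  cases p with
  | nil => rfl
  | cons hadj q =>
    obtain ⟨j, -, hj⟩ := hadj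
    exact absurd (hS A hA j (Finset.mem_union_left _ hj)) (Finset.disjoint_left.1 hdisj hj)

/-- ★ **a face of `S` is linked in `ξ ∪ E` to no face off `S`** (rootless attachment). [cite: KhristoforovSmirnov2021, §1.2 (arXiv v1 p. 2: `IP(ξ)` is a union of disjoint paths)] -/
theorem not_reachable_union_rootless (hS : ∀ F ∈ S, ∀ j : Fin 3, side F j ∈ ξ ∪ E → side F j ∈ E) (hR : ∀ F, F ∉ S → ∀ j : Fin 3, side F j ∉ E)
    (hdisj : Disjoint ξ E) {A Y : HexVertex} (hA : A ∈ S) (hY : Y ∉ S) : ¬ (sideGraph (ξ ∪ E)).Reachable A Y := by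
  rintro ⟨p⟩
  have h := (reachable_of_walk_union_pendant (R := A) hS (fun F hF _ => hR F hF) hdisj hY p.length p le_rfl).2 hA
  exact hY ((eq_of_reachable_of_mem hS hdisj hA h) ▸ hA)

/-- walks from a face of `S` stay in `S` and use only `E`-bonds (rootless attachment). [cite: KhristoforovSmirnov2021, §1.2 (arXiv v1 p. 2)] -/
theorem reachable_E_of_walk_union_rootless (hS : ∀ F ∈ S, ∀ j : Fin 3, side F j ∈ ξ ∪ E → side F j ∈ E) (hR : ∀ F, F ∉ S → ∀ j : Fin 3, side F j ∉ E) (n : ℕ) :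
    ∀ {A B : HexVertex} (p : (sideGraph (ξ ∪ E)).Walk A B), p.length ≤ n → A ∈ S → B ∈ S ∧ (sideGraph E).Reachable A B := by
  induction n with
  | zero =>
    intro A B p hp hA
    cases p with
    | nil => exact ⟨hA, SimpleGraph.Reachable.refl _⟩
    | cons h q => simp at hp
  | succ n ih =>
    intro A B p hp hA
    cases p with
    | nil => exact ⟨hA, SimpleGraph.Reachable.refl _⟩
    | cons hadj q =>
      rename_i A₁
      rw [SimpleGraph.Walk.length_cons] at hp
      obtain ⟨j, hA₁, hj⟩ := hadj
      have hjE : side A j ∈ E := hS A hA j hj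
      -- the next face has the `E`-side `side A j`, hence lies in `S`
      have hA₁S : A₁ ∈ S := by
        by_contra h1
        refine hR A₁ h1 (oppIdx A j) ?_
        rw [hA₁, side_oppFace_oppIdx]; exact hjE
      obtain ⟨hB, hr⟩ := ih q (by omega) hA₁S
      exact ⟨hB, (show (sideGraph E).Adj A A₁ from ⟨j, hA₁, hjE⟩).reachable.trans hr⟩

/-- ★ **two faces of `S` are linked in `ξ ∪ E` iff they are linked inside `E`** (rootless attachment). [cite: KhristoforovSmirnov2021, §1.2 (arXiv v1 p. 2: `IP(ξ)` is a union of disjoint paths)] -/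
theorem reachable_union_rootless_inner (hS : ∀ F ∈ S, ∀ j : Fin 3, side F j ∈ ξ ∪ E → side F j ∈ E) (hR : ∀ F, F ∉ S → ∀ j : Fin 3, side F j ∉ E)
    {A B : HexVertex} (hA : A ∈ S) : (sideGraph (ξ ∪ E)).Reachable A B ↔ (sideGraph E).Reachable A B := by
  constructor
  · rintro ⟨p⟩
    exact (reachable_E_of_walk_union_rootless hS hR p.length p le_rfl hA).2
  · exact fun h => h.mono (ht2_sideGraph_mono Finset.subset_union_right)

end Rootless

/-! ### The three-valent junction -/

section Junction

/-- `Fin 3` bookkeeping. [folklore] -/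
private theorem fin3_univ (a : Fin 3) : (Finset.univ : Finset (Fin 3)) = {a, a + 1, a + 2} := by
  revert a; decide

/-- ★ **PARITY AT A FACE ALL OF WHOSE SIDES MAY BE PRESENT**: the side count of `E` at `F` is odd iff an odd number of the three sides `side F a`, `side F (a+1)`, `side F (a+2)` lie
in `E` — the device for the outer junction face of two attached cells, which is three-valent in the new bonds. [cite: KhristoforovSmirnov2021, §1.2 (arXiv v1 p. 2: loop configurations)] -/
theorem odd_xiDeg_iff_three (E : Finset (Sym2 (Site 2))) (F : HexVertex) (a : Fin 3) :
    Odd (xiDeg E F) ↔ ¬ (side F a ∈ E ↔ ¬ (side F (a + 1) ∈ E ↔ side F (a + 2) ∈ E)) := by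
  classical
  have h3 : ∀ b : Fin 3, b ≠ b + 1 ∧ b ≠ b + 2 ∧ b + 1 ≠ b + 2 := by decide
  obtain ⟨h01, h02, h12⟩ := h3 a
  rw [l1_xiDeg_eq, fin3_univ a, Finset.filter_insert, Finset.filter_insert, Finset.filter_singleton]
  by_cases h0 : side F a ∈ E <;> by_cases h1 : side F (a + 1) ∈ E <;> by_cases h2 : side F (a + 2) ∈ E <;>
    simp [h0, h1, h2, h01, h02, h12, Nat.odd_iff]

end Junction

end Literature.Probability.Percolation.MarkedLoops
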